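import Literature.NumberTheory.EllipticCurves.PadicSigma
import Literature.NumberTheory.EllipticCurves.PadicSigmaVeluKernelDataProofs
import Mathlib.RingTheory.Valuation.LocalSubring
import Mathlib.RingTheory.Localization.AtPrime.Basic
import Mathlib.FieldTheory.IsAlgClosed.AlgebraicClosure
import HarnessLib

/-!
# `WeierstrassCurve.mazur_tate_sigma_existsUnique` holds (Mazur–Stein–Tate 2006, Thm. 1.3;
# Mazur–Tate 1991, Thm. 3.1 — via Blakestad–Grant 2023, Thm. 1; proofs only)

Trunk T-NT-EC (Literature/NumberTheory/EllipticCurves). This file discharges the tree's named fact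
`WeierstrassCurve.mazur_tate_sigma_existsUnique` (`PadicSigma.lean`): for an elliptic curve over
`ℚ` with good ordinary reduction at `p ≥ 5` there is exactly one Mazur–Tate pair `(σ, c)`.
Uniqueness is `PadicSigmaUniqueness*Proofs`; existence is Blakestad–Grant's theorem on the
integrality of the universal `p`-adic sigma function (J. Number Theory 249 (2023), Thm. 1), whose
proof the tree carries in full: Thm. 2 (`PadicWeierstrassZetaProofs`), the reduction of the fact to
`exp(∫ζ̃ω) ∈ ℤ_p⟦t⟧` (`PadicSigmaOfZetaProofs`), the universal ring `R̂` and Thm. 15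
(`UniversalOrdinaryRing`, `UniversalSigmaSpecializationProofs`), Prop. 13 and Dwork's lemma
(`PadicSigmaIsogenyCriterionProofs`, `PadicSigmaKohelCriterionProofs`,
`PadicSigmaVeluKernelBridgeProofs.mazur_tate_sigma_existsUnique_of_veluKernelData`), and the
geometry of the canonical `p`-isogeny (Prop. 7, Lemmas 10–12: `VeluOddKernelProofs`,
`VeluNormProofs`, `VeluKernelReductionProofs`, `VeluLogDerivativeProofs`, `CanonicalKernelProofs`,
`CanonicalKernelHenselProofs`, `PadicSigmaVeluKernelDataProofs`).

What remains, and is done here, is to realise the abstract "generic fibre" tower of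
`PadicSigmaVeluKernelDataProofs.exists_veluKernelData_of_rings` for `R̂ = completeRing p`:
`𝒪 = R̂_{(p)}` (a discrete valuation ring since `pR̂` is prime and `R̂` is `p`-adically separated:
every `r ≠ 0` is `pᵃr'` with `r' ∉ pR̂`), `K₀ = Frac R̂`, `F = K̄₀`, `S ⊆ F` a valuation ring
dominating `𝒪` (Chevalley: Mathlib's `IsLocalRing.exists_factor_valuationRing`), `k` its residue
field; the descent `R̂[1/p] ∩ R̂_{(p)} = R̂` is `pᵃ ∣ rs, s ∉ pR̂ ⇒ pᵃ ∣ r`.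

* `UniversalOrdinary.veluKernelData` — the hypothesis of
  `mazur_tate_sigma_existsUnique_of_veluKernelData` for every `p ≥ 5`;
* **`WeierstrassCurve.mazur_tate_sigma_existsUnique_holds`** — the named fact.

## Sources

* B. Mazur, W. Stein, J. Tate, *Computation of `p`-adic heights and log convergence*, Doc. Math.
  Extra Vol. Coates (2006), Thm. 1.3 (= B. Mazur, J. Tate, *The `p`-adic sigma function*, Duke
  Math. J. 62 (1991), Thm. 3.1). [MazurSteinTate2006]
* C. Blakestad, D. Grant, *On the universal `p`-adic sigma and Weierstrass zeta functions*,
  J. Number Theory 249 (2023) 348–376 (arXiv:1903.02480), Thm. 1, Prop. 7, Thm. 15.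
  [BlakestadGrant2023]

Pure proof file: no definitions, no named facts.
-/

noncomputable section

open scoped Classical
open Polynomial

namespace Literature.NumberTheory.EllipticCurves.UniversalOrdinary

open Literature.RingTheory.AdicTopology

variable (p : ℕ) [Fact p.Prime]

omit [Fact p.Prime] in
/-- **`R̂` is `p`-adically separated with `pR̂` prime: every `r ≠ 0` is `pᵃ·r'` with `r' ∉ pR̂`.**
[folklore] -/
theorem exists_pow_mul_not_mem_completeRing {r : completeRing p} (hr : r ≠ 0) :
    ∃ (a : ℕ) (r' : completeRing p), r' ∉ Ideal.span {(p : completeRing p)} ∧ r = (p : completeRing p) ^ a * r' := by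
  obtain ⟨n, y, hy, hyn⟩ := exists_eq_pow_mul_not_mem (p : localizedRing p) hr
  rw [algebraMap_natCast] at hy hyn
  exact ⟨n, y, hyn, hy⟩

/-- `pᵃ ∣ r·s` with `s ∉ pR̂` forces `pᵃ ∣ r` (`pR̂` prime, `R̂` a domain; `p ≥ 5`). [folklore] -/
theorem pow_dvd_of_pow_dvd_mul_completeRing (hp5 : 5 ≤ p) {a : ℕ} {r s : completeRing p}
    (hs : s ∉ Ideal.span {(p : completeRing p)}) (h : (p : completeRing p) ^ a ∣ r * s) :
    (p : completeRing p) ^ a ∣ r := by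
  haveI := isDomain_completeRing p hp5
  have hprime := span_natCast_isPrime_completeRing p hp5
  induction a generalizing r with
  | zero => rw [pow_zero]; exact one_dvd _
  | succ a ih =>
    have h1 : (p : completeRing p) ∣ r * s := (dvd_pow_self _ (Nat.succ_ne_zero a)).trans h
    have h2 : r ∈ Ideal.span {(p : completeRing p)} := by
      rcases hprime.mem_or_mem (Ideal.mem_span_singleton.mpr h1) with h | h
      · exact h
      · exact absurd h hs
    obtain ⟨r₁, rfl⟩ := Ideal.mem_span_singleton.mp h2
    obtain ⟨c, hc⟩ := h
    have h3 : (p : completeRing p) ^ a ∣ r₁ * s := by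
      refine ⟨c, mul_left_cancel₀ (natCast_prime_ne_zero p hp5) ?_⟩
      rw [← mul_assoc, hc, pow_succ]; ring
    obtain ⟨d, hd⟩ := ih h3
    exact ⟨d, by rw [hd, pow_succ]; ring⟩

set_option maxHeartbeats 1000000 in
/-- **The Vélu kernel data of the canonical `p`-isogeny of the universal ordinary curve**
(Blakestad–Grant 2023, Prop. 7, in the form consumed by
`mazur_tate_sigma_existsUnique_of_veluKernelData`), for every `p ≥ 5`: the abstract tower of
`exists_veluKernelData_of_rings` realised by `𝒪 = R̂_{(p)}`, `K₀ = Frac R̂`, `F = K̄₀`, a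
valuation ring `S ⊆ F` dominating `𝒪`, and its residue field.
[Blakestad–Grant 2023, Prop. 7] [cite: BlakestadGrant2023, Prop. 7] -/
theorem veluKernelData (hp5 : 5 ≤ p) :
    ∃ (n : ℕ) (_ : 2 * n + 1 = p) (φO U₀ M₀ : (completeRing p)[X]) (A₀ B₀ : completeRing p)
        (D : (completeRingQ p)[X]) (T₀ : completeRingQ p),
        φO.natDegree ≤ n ∧ φO.coeff n = p ∧ (∀ i, 1 ≤ i → (p : completeRing p) ∣ φO.coeff i) ∧
        IsUnit (φO.coeff 0) ∧
        U₀.natDegree ≤ p ∧ U₀.coeff p = 1 ∧ (∀ i, (p : completeRing p) ∣ (U₀ - Polynomial.X ^ p).coeff i) ∧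
        M₀.natDegree ≤ 3 * n ∧ M₀.coeff (3 * n) = 1 ∧
        (∀ i, (p : completeRing p) ∣ (M₀ - (Polynomial.X ^ 3 + Polynomial.C (univA₄ p) * Polynomial.X +
          Polynomial.C (univA₆ p)) ^ n).coeff i) ∧
        (Polynomial.X ^ 3 + Polynomial.C (univA₄ p) * Polynomial.X + Polynomial.C (univA₆ p)) * M₀ ^ 2 =
          U₀ ^ 3 + Polynomial.C A₀ * U₀ * φO ^ 4 + Polynomial.C B₀ * φO ^ 6 ∧
        (p : completeRing p) ∣ A₀ * φO.coeff 0 ^ 4 - univA₄ p ^ p ∧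
        (p : completeRing p) ∣ B₀ * φO.coeff 0 ^ 6 - univA₆ p ^ p ∧
        Polynomial.derivative U₀ * φO - 2 * U₀ * Polynomial.derivative φO = Polynomial.C (p : completeRing p) * M₀ ∧
        Polynomial.C (p : completeRingQ p) * D = φO.map (algebraMap (completeRing p) (completeRingQ p)) ∧
        U₀.map (algebraMap (completeRing p) (completeRingQ p)) =
          (Polynomial.C (p : completeRingQ p) * Polynomial.X - Polynomial.C T₀) * D ^ 2 -
            ((universalCurve p).map (algebraMap (completeRing p) (completeRingQ p))).veluLogOp D := by
  have hpp : p.Prime := Fact.out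
  set R := completeRing p with hR
  haveI : IsDomain R := isDomain_completeRing p hp5
  set P : Ideal R := Ideal.span {(p : R)} with hP
  haveI hPprime : P.IsPrime := span_natCast_isPrime_completeRing p hp5
  have hpR0 : (p : R) ≠ 0 := natCast_prime_ne_zero p hp5
  -- `K₀ = Frac R̂`, `𝒪 = R̂_(p)`, `F = K̄₀`
  let K₀ := FractionRing R
  let 𝒪 := Localization.AtPrime P
  set jR : R →+* 𝒪 := algebraMap R 𝒪 with hjR
  have hjRinj : Function.Injective jR := IsLocalization.injective 𝒪 P.primeCompl_le_nonZeroDivisors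
  have hRK₀inj : Function.Injective (algebraMap R K₀) := IsFractionRing.injective R K₀
  have hg : ∀ s : P.primeCompl, IsUnit (algebraMap R K₀ s) := fun s =>
    IsUnit.mk0 _ fun h0 => by
      have : (s : R) = 0 := hRK₀inj (by rw [h0, RingHom.map_zero])
      exact s.2 (by rw [this]; exact P.zero_mem)
  set j : 𝒪 →+* K₀ := IsLocalization.lift hg with hj
  have hjjR : j.comp jR = algebraMap R K₀ := IsLocalization.lift_comp hg
  have hgs0 : ∀ s : P.primeCompl, algebraMap R K₀ s ≠ 0 := fun s => (hg s).ne_zero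
  have hjmk : ∀ (r : R) (s : P.primeCompl), j (IsLocalization.mk' 𝒪 r s) = algebraMap R K₀ r * (algebraMap R K₀ s)⁻¹ :=
    fun r s => (IsLocalization.lift_mk'_spec hg r _ s).mpr (by rw [mul_comm, inv_mul_cancel_right₀ (hgs0 s)])
  have hjinj : Function.Injective j := by
    intro x y hxy
    obtain ⟨⟨rx, sx⟩, rfl⟩ := IsLocalization.mk'_surjective P.primeCompl x
    obtain ⟨⟨ry, sy⟩, rfl⟩ := IsLocalization.mk'_surjective P.primeCompl y
    rw [hjmk, hjmk, mul_inv_eq_iff_eq_mul₀ (hgs0 sx), mul_assoc, mul_comm _ (algebraMap R K₀ sx), ← mul_assoc,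
      eq_comm, mul_inv_eq_iff_eq_mul₀ (hgs0 sy)] at hxy
    rw [IsLocalization.mk'_eq_iff_eq]
    exact congrArg _ (hRK₀inj (by rw [map_mul, map_mul]; linear_combination hxy.symm))
  haveI : CharZero R := by
    haveI := isAddTorsionFree_completeRing p hp5
    refine charZero_of_inj_zero fun n hn => ?_
    by_contra hn0
    have h := IsAddTorsionFree.nsmul_right_injective hn0 (a₁ := (1 : R)) (a₂ := 0)
      (by simp only [nsmul_eq_mul, mul_one, mul_zero]; exact hn)
    exact one_ne_zero h
  haveI : CharZero K₀ := charZero_of_injective_algebraMap hRK₀inj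
  let F := AlgebraicClosure K₀
  set ι₀ : K₀ →+* F := algebraMap K₀ F with hι₀
  -- a valuation ring of `F` dominating `𝒪` (Chevalley)
  obtain ⟨A, hAmem, hloc⟩ := IsLocalRing.exists_factor_valuationRing (ι₀.comp j)
  set ι : 𝒪 →+* A := (ι₀.comp j).codRestrict A.toSubring hAmem with hιdef
  have hιval : ∀ x : 𝒪, ((ι x : A) : F) = ι₀ (j x) := fun x => rfl
  have hnonunit : ∀ x : 𝒪, ¬ IsUnit x → ¬ IsUnit (ι x) := fun x hx hu => hx (hloc.map_nonunit x hu)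
  -- the valuation, its integers, the residue field
  have hv : A.valuation.Integers A :=
    { hom_inj := Subtype.val_injective
      map_le_one := fun x => A.valuation_le_one x
      exists_of_le_one := fun r hr => ⟨⟨r, (A.valuation_le_one_iff r).mp hr⟩, rfl⟩ }
  set k := IsLocalRing.ResidueField A with hk
  set π : A →+* k := IsLocalRing.residue A with hπ
  -- `p` on the various levels
  have hpO : (p : 𝒪) ≠ 0 := by rw [← map_natCast jR]; exact fun h => hpR0 (hjRinj (by rw [h, RingHom.map_zero]))
  have hmaxO : IsLocalRing.maximalIdeal 𝒪 = Ideal.span {(p : 𝒪)} := by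
    rw [← Localization.AtPrime.map_eq_maximalIdeal]
    change Ideal.map (algebraMap R 𝒪) (Ideal.span {(p : R)}) = _
    rw [Ideal.map_span, Set.image_singleton, map_natCast]
  have hpOmax : (p : 𝒪) ∈ IsLocalRing.maximalIdeal 𝒪 := by rw [hmaxO]; exact Ideal.mem_span_singleton_self _
  have hpOnu : ¬ IsUnit (p : 𝒪) := (IsLocalRing.mem_maximalIdeal _).mp hpOmax
  have hpS : ι (p : 𝒪) ∈ IsLocalRing.maximalIdeal A := (IsLocalRing.mem_maximalIdeal _).mpr (hnonunit _ hpOnu)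
  haveI : CharP k p := by
    refine (CharP.charP_iff_prime_eq_zero hpp).mpr ?_
    rw [← map_natCast π, hπ, IsLocalRing.residue_eq_zero_iff, ← map_natCast ι]
    exact hpS
  -- units of `𝒪`: elements of `R̂ ∖ pR̂`
  have hunitO : ∀ r : R, r ∉ P → IsUnit (jR r) := fun r hr =>
    IsLocalization.map_units 𝒪 (⟨r, hr⟩ : P.primeCompl)
  have hnatP : ∀ m : ℕ, 0 < m → m < p → (m : R) ∉ P := by
    intro m hm0 hmp hmem
    haveI := charP_quotient p hp5
    have h0 : (m : R ⧸ P) = 0 := by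
      rw [← map_natCast (Ideal.Quotient.mk P), Ideal.Quotient.eq_zero_iff_mem]; exact hmem
    rw [CharP.cast_eq_zero_iff (R ⧸ P) p] at h0
    exact absurd (Nat.le_of_dvd hm0 h0) (by omega)
  have h3 : IsUnit (3 : 𝒪) := by
    have h := hunitO _ (hnatP 3 (by norm_num) (by omega))
    rw [map_natCast] at h
    simpa using h
  have h2 : ¬ (p : 𝒪) ∣ 2 := by
    intro hdvd
    have h2u : IsUnit (2 : 𝒪) := by
      have h := hunitO _ (hnatP 2 (by norm_num) (by omega))
      rw [map_natCast] at h
      simpa using h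
    exact hpOnu (isUnit_of_dvd_unit hdvd h2u)
  have hprimeO : (Ideal.span {(p : 𝒪)}).IsPrime := by rw [← hmaxO]; exact Ideal.IsMaximal.isPrime inferInstance
  have hker : ∀ c : 𝒪, π (ι c) = 0 → (p : 𝒪) ∣ c := fun c hc => by
    rw [hπ, IsLocalRing.residue_eq_zero_iff] at hc
    have hcu : ¬ IsUnit c := fun hu => (IsLocalRing.mem_maximalIdeal _).mp hc
      (by rw [hιdef]; exact (hu.map _))
    have := (IsLocalRing.mem_maximalIdeal _).mpr hcu
    rw [hmaxO] at this
    exact Ideal.mem_span_singleton.mp this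
  -- integrally closed: monic polynomials over `A` have all their `F`-roots in `A`
  have hint : ∀ q : (A : Type _)[X], q.Monic → ∀ c : F, (q.map (algebraMap A F)).IsRoot c →
      c ∈ Set.range (algebraMap A F) := fun q hq c hc => by
    have hI : IsIntegral A c := ⟨q, hq, by rwa [Polynomial.eval₂_eq_eval_map]⟩
    exact IsIntegrallyClosed.algebraMap_eq_of_integral hI
  -- `K = R̂[1/p] → K₀`
  set K := completeRingQ p with hK
  have hpK₀ : IsUnit (algebraMap R K₀ (p : R)) :=
    IsUnit.mk0 _ fun h0 => hpR0 (hRK₀inj (by rw [h0, RingHom.map_zero]))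
  set iK : K →+* K₀ := IsLocalization.Away.lift (p : R) hpK₀ with hiKdef
  have hiK : iK.comp (algebraMap R K) = j.comp jR := by
    rw [hjjR, hiKdef]; exact IsLocalization.Away.lift_comp (p : R) hpK₀
  have hiKα : ∀ r : R, iK (algebraMap R K r) = algebraMap R K₀ r := fun r => by
    rw [← RingHom.comp_apply, hiK, hjjR]
  have hjjR' : ∀ r : R, j (jR r) = algebraMap R K₀ r := fun r => by rw [← RingHom.comp_apply, hjjR]
  -- descent `K ∩ 𝒪 = R̂` inside `K₀`
  have hdesc : ∀ (x : K) (y : 𝒪), iK x = j y → ∃ r, algebraMap R K r = x := by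
    intro x y hxy
    obtain ⟨⟨r, m⟩, hrm⟩ := IsLocalization.surj (Submonoid.powers (p : R)) x
    obtain ⟨a, ha⟩ := m.2
    obtain ⟨⟨r', s⟩, hrs⟩ := IsLocalization.surj P.primeCompl y
    have e1 : iK x * algebraMap R K₀ (m : R) = algebraMap R K₀ r := by
      have h := congrArg iK hrm; rwa [map_mul, hiKα, hiKα] at h
    have e2 : j y * algebraMap R K₀ (s : R) = algebraMap R K₀ r' := by
      have h := congrArg j hrs; rwa [map_mul, ← hjR, hjjR', hjjR'] at h
    have ha' : (p : R) ^ a = (m : R) := ha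
    have e3 : r * s = (p : R) ^ a * r' := by
      apply hRK₀inj
      rw [map_mul, map_mul, ← e1, ← e2, hxy, ha']; ring
    have hsP : (s : R) ∉ P := s.2
    obtain ⟨r₀, hr₀⟩ := pow_dvd_of_pow_dvd_mul_completeRing p hp5 hsP ⟨r', e3⟩
    refine ⟨r₀, ?_⟩
    have hmu : IsUnit (algebraMap R K (m : R)) := IsLocalization.map_units K m
    refine (hmu.mul_left_inj).mp ?_
    rw [hrm, ← map_mul, ← ha', mul_comm, ← hr₀]
  -- `S ∩ K₀ = 𝒪`: `𝒪` is a valuation ring of `K₀` dominated by `S`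
  have hOK : ∀ x : K₀, ι₀ x ∈ Set.range (algebraMap A F) → x ∈ Set.range j := by
    rintro x ⟨t, ht⟩
    by_cases hx0 : x = 0
    · exact ⟨0, by rw [RingHom.map_zero, hx0]⟩
    obtain ⟨r, s, hs, hxrs⟩ := IsFractionRing.div_surjective (A := R) x
    have hs0 : s ≠ 0 := nonZeroDivisors.ne_zero hs
    have hr0 : r ≠ 0 := fun h => by
      rw [h, RingHom.map_zero, zero_div] at hxrs; exact hx0 hxrs.symm
    obtain ⟨a, r₁, hr₁, hra⟩ := exists_pow_mul_not_mem_completeRing p hr0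
    obtain ⟨b, s₁, hs₁, hsb⟩ := exists_pow_mul_not_mem_completeRing p hs0
    have hgp : algebraMap R K₀ (p : R) ≠ 0 := hpK₀.ne_zero
    have hgr₁ : algebraMap R K₀ r₁ ≠ 0 := fun h0 => hr₁ (by
      rw [hRK₀inj (h0.trans (RingHom.map_zero _).symm)]; exact Ideal.zero_mem _)
    have hgs₁ : algebraMap R K₀ s₁ ≠ 0 := fun h0 => hs₁ (by
      rw [hRK₀inj (h0.trans (RingHom.map_zero _).symm)]; exact Ideal.zero_mem _)
    set g := algebraMap R K₀ with hgdef
    rcases le_or_gt b a with hab | hab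
    · obtain ⟨c, rfl⟩ := Nat.exists_eq_add_of_le hab
      set u := (hunitO s₁ hs₁).unit with hu
      have hju : j (↑u⁻¹ : 𝒪) * g s₁ = 1 := by
        rw [← hjjR' s₁, ← map_mul, show jR s₁ = (u : 𝒪) from (IsUnit.unit_spec _).symm, Units.inv_mul, map_one]
      refine ⟨jR ((p : R) ^ c * r₁) * ↑u⁻¹, ?_⟩
      have hden : g ((p : R) ^ b * s₁) ≠ 0 := by
        rw [map_mul, map_pow]; exact mul_ne_zero (pow_ne_zero _ hgp) hgs₁
      rw [← hxrs, hra, hsb, map_mul, hjjR', eq_div_iff hden, pow_add]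
      simp only [map_mul, map_pow]
      linear_combination g (p : R) ^ c * g r₁ * g (p : R) ^ b * hju
    · exfalso
      obtain ⟨c, rfl⟩ := Nat.exists_eq_add_of_lt hab
      set w := (hunitO r₁ hr₁).unit with hw
      have hjw : j (↑w⁻¹ : 𝒪) * g r₁ = 1 := by
        rw [← hjjR' r₁, ← map_mul, show jR r₁ = (w : 𝒪) from (IsUnit.unit_spec _).symm, Units.inv_mul, map_one]
      set y : 𝒪 := jR ((p : R) ^ (c + 1) * s₁) * ↑w⁻¹ with hy
      have hyu : ¬ IsUnit y := by
        refine (IsLocalRing.mem_maximalIdeal _).mp ?_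
        rw [hmaxO, hy]
        refine Ideal.mul_mem_right _ _ (Ideal.mem_span_singleton.mpr ⟨jR ((p : R) ^ c * s₁), ?_⟩)
        rw [← map_natCast jR, ← map_mul, pow_succ]; congr 1; ring
      have hjy : j y * x = 1 := by
        have hden : g ((p : R) ^ (a + c + 1) * s₁) ≠ 0 := by
          rw [map_mul, map_pow]; exact mul_ne_zero (pow_ne_zero _ hgp) hgs₁
        rw [hy, ← hxrs, hra, hsb, map_mul, hjjR', mul_div_assoc', div_eq_one_iff_eq hden,
          show a + c + 1 = (c + 1) + a by ring, pow_add]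
        simp only [map_mul, map_pow]
        linear_combination g (p : R) ^ (c + 1) * g s₁ * g (p : R) ^ a * hjw
      have hιy : ι y * t = 1 := by
        apply Subtype.val_injective
        show ((ι y : A) : F) * (t : F) = 1
        rw [hιval, show ((t : A) : F) = algebraMap A F t from rfl, ht, ← map_mul, hjy, map_one]
      exact hnonunit y hyu (IsUnit.of_mul_eq_one _ hιy)
  have hcomm : (algebraMap A F).comp ι = ι₀.comp j := RingHom.ext fun x => rfl
  have hfS : Function.Injective (algebraMap A F) := Subtype.val_injective
  exact exists_veluKernelData_of_rings p hp5 hv jR j ι₀ ι π iK hcomm hiK hjinj hjRinj hfS hOK hker hpS h3 h2 hprimeO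
    hpO hdesc hint

end Literature.NumberTheory.EllipticCurves.UniversalOrdinary

/-! ### The named fact -/

namespace WeierstrassCurve

/-- **Mazur–Stein–Tate 2006, Thm. 1.3 (Mazur–Tate 1991, Thm. 3.1): existence and uniqueness of the
canonical `p`-adic sigma function** — the tree's named fact
`WeierstrassCurve.mazur_tate_sigma_existsUnique` holds: for `E/ℚ` (globally minimal model) with
good ordinary reduction at `p ≥ 5` there is exactly one Mazur–Tate pair `(σ, c)` for `E/ℚ_p`.
Proof: Blakestad–Grant 2023, Thm. 1 (integrality of the universal `p`-adic sigma function), as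
assembled by `mazur_tate_sigma_existsUnique_of_veluKernelData` from the Vélu kernel data of the
canonical `p`-isogeny of the universal ordinary curve (`UniversalOrdinary.veluKernelData`).
[Mazur–Stein–Tate 2006, Thm. 1.3; Mazur–Tate 1991, Thm. 3.1; Blakestad–Grant 2023, Thm. 1]
[cite: MazurSteinTate2006, Thm. 1.3] -/
theorem mazur_tate_sigma_existsUnique_holds : mazur_tate_sigma_existsUnique :=
  Literature.NumberTheory.EllipticCurves.UniversalOrdinary.mazur_tate_sigma_existsUnique_of_veluKernelData fun p _ hp5 =>
    Literature.NumberTheory.EllipticCurves.UniversalOrdinary.veluKernelData p hp5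

end WeierstrassCurve
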